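import Literature.Topology.FourManifolds.SeifertAdaptedTube
import Literature.Topology.FourManifolds.SeifertFramingZero
import Literature.Topology.FourManifolds.DehnSurgeryTubularUniqueness
import Literature.Topology.FourManifolds.KirbyMovesShrinkProofs
import HarnessLib

/-!
# Seifert surfaces in normal position with respect to a zero-framed tube

Topic `Literature/Topology/FourManifolds`; fact seat
`provefact-Literature.Topology.FourManifolds.isUnknot_of_isIntegralSurgery_zero` (Property R,
D. Gabai, *Foliations and the topology of 3-manifolds. III*, J. Differential Geom. 26 (1987),
Cor. 8.3 and Remark 8.5). Fourth **proved** brick of the printed line, completing the normalisation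
presupposed by Gabai's Corollary 8.2 (p. 525: *"Let `S` be a minimal genus Seifert surface for a
knot `k` in `S³`. The manifold `M` obtained by performing zero frame surgery to `k` … has a compact
leaf `Ŝ` such that `Ŝ - N̊(k) = S` … Cap off `S` by a disc to create `Ŝ`"*): **every Seifert
surface of `K`, of any genus, can be moved by an ambient diffeomorphism fixing `K` into normal
position with respect to any oriented tubular neighbourhood `ν₀` of `K` of framing `0`** — the
unit tube `ν₀ (𝕊¹ × D̊²)` (the solid torus removed by the zero frame surgery
`IsIntegralSurgery _ _ K 0`, whose meridian discs `ν₀ ({u} × D̊²)` are bounded by meridians and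
whose longitudes `ν₀ (𝕊¹ × {x e₀})` are the `0`-framed push-offs) then meets the surface exactly
in its positive `e₀`-half-discs `ν₀ (𝕊¹ × [0, 1) e₀)`, which form the collar of `∂S = K` in the
surface (`Knot.NormalSeifertData`, `Knot.IsSpanningSurfaceOfGenus.nonempty_normalSeifertData`,
`Knot.exists_normalSeifertData`). In the smooth category this is the classical fact that a surface
spanning `K` "can be arranged so that it meets `∂V` in [a] preferred longitude" (Cromwell, *Knots
and Links* (2004), proof of Thm. 5.8.1, Steps 1–5; Rolfsen (1976), §5), made effective by
uniqueness of framed tubular neighbourhoods.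

## Proof

1. The tube `ν` adapted to `F` (`SeifertAdaptedTube.lean`: Hirsch's tube over the frame
   velocity–conormal–normal, squeezed) has its positive `e₀`-half-planes in `F(S)` and its
   longitude a collar loop of `F(S)`; by `SeifertFramingZero.lean` (the Seifert longitude is
   null-homologous in `S³ ∖ K`, Gabai Def. 8.1) **`ν` has framing `0`**
   (`hasFraming_zero_adaptedTube`), and so has its fibrewise rescaling `ν.scale r`
   (`Knot.TubularNbhd.HasFraming.scale`) to a radius `r` so thin that `F(S)` meets
   `ν (𝕊¹ × B (0, r))` only in the half-planes (`exists_radius_forall_eq_single`).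
2. **Uniqueness of framed tubes** (`Knot.TubularNbhd.exists_diffeomorph_eq_of_hasFraming`,
   `DehnSurgeryTubularUniqueness.lean`; Kosinski, *Differential Manifolds* III (3.5), sharpened by
   the framing integer, Gompf–Stipsicz §4.5): a diffeomorphism `Φ` of `𝕊³` fixing `K` pointwise
   with `Φ (ν.scale r (u, w)) = ν₀ (u, w)` for `‖w‖ < 1`.
3. **Transport**: `Φ ∘ F` is again a Seifert surface of `K` of the same genus and boundary
   identification (`transport_isSpanning`: smoothness and immersion through
   `ContMDiff.codRestrict_sphere`, `Diffeomorph.mfderivToContinuousLinearEquiv`,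
   `mfderiv_coe_sphere_injective`; `Φ` fixes `K`), and it is in normal position with height
   profile `τ x = ρ (r x) = a x / √(1 + (b x)²)` (`a = δ r`, `b = r`).

## Main results (all proved; no named facts)

* `Knot.NormalSeifertData ν₀ S e g c` — the structure "Seifert surface of genus `g` over the
  abstract surface `S` (boundary identification `e`, capping data `c`) in normal position with
  respect to `ν₀`", with the explicit height profile;
* `Knot.IsSpanningSurfaceOfGenus.hasFraming_zero_adaptedTube` — the adapted tube has framing `0`;
* `Knot.IsSpanningSurfaceOfGenus.transport_isSpanning` — transport of Seifert surfaces along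
  diffeomorphisms of `𝕊³` fixing the knot;
* `Knot.IsSpanningSurfaceOfGenus.nonempty_normalSeifertData`, `Knot.exists_normalSeifertData` —
  **normal position** for every Seifert surface / in every Seifert genus of `K`, for every
  `0`-framed oriented tube `ν₀`.

## References

* D. Gabai, *Foliations and the topology of 3-manifolds. III*, J. Differential Geom. 26 (1987)
  479–536, Def. 8.1, Cor. 8.2 (pp. 524–525). [GabaiJDG1987]
* P. Cromwell, *Knots and Links* (2004), §4.2, Thm. 5.8.1 and its proof. [Cromwell2004]
* A. A. Kosinski, *Differential Manifolds* (1993), Ch. III Thm. (3.5). [Kosinski1993]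
* R. Gompf, A. Stipsicz, *4-Manifolds and Kirby Calculus* (1999), §4.5, §5.3. [GompfStipsicz1999]
* A. Juhász, *Differential and Low-Dimensional Topology* (2023), Remark 4.12. [Juhasz2023]

## Design notes

* `NormalSeifertData` carries the transported embedding `F`, the proofs that it is a spanning
  surface on `𝕊³`, and the height profile with its explicit formula (a diffeomorphism of `[0, ∞)`
  onto `[0, a/b)`), so that the capping construction (Gabai's `Ŝ`) can glue the open unit disc to
  the interior of `S` along `x e^{iθ} ↔ CS (e⁻¹ e^{iθ}, τ x)` smoothly.
* No `sorry`, no new instances; local notations as in the sibling files.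
-/

open scoped Manifold ContDiff Topology RealInnerProductSpace
open Function Set Module

noncomputable section

namespace Literature.Topology.FourManifolds

/-- Local notation: `𝔼 n` is the model Euclidean space `EuclideanSpace ℝ (Fin n)`. -/
local notation "𝔼 " n:arg => EuclideanSpace ℝ (Fin n)

/-- Local notation: `𝕊 n` is the unit sphere in `EuclideanSpace ℝ (Fin (n + 1))`. -/
local notation "𝕊 " n:arg => (Metric.sphere (0 : EuclideanSpace ℝ (Fin (n + 1))) 1)

attribute [local instance] fact_finrank_euclideanSpace_two fact_finrank_euclideanSpace_four


namespace Knot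

variable {K : Knot}

/-- **A Seifert surface of `K` in normal position** with respect to the oriented tubular
neighbourhood `ν₀` of `K` and the collar `c.CS` of the abstract surface: a Seifert surface
`F : S ↪ 𝕊³` of genus `g` (`IsSpanningSurfaceOfGenus F e g`, `‖F‖ = 1`) together with a height
profile `τ` such that the unit tube of `ν₀` meets `F(S)` exactly in its positive `e₀`-half-discs,
which are the collar lines of `∂S`: `F (CS (z, τ x)) = ν₀ (e z, x e₀)` for `0 ≤ x < 1`, and every
surface point `F y = ν₀ (u, w)` with `‖w‖ < 1` is of this form. This is the normal position
`Ŝ - N̊(k) = S` of Gabai (1987), Cor. 8.2 (equivalently: `F(S)` meets the solid torus `ν₀ (𝕊¹ × D²)`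
in an annulus whose inner boundary is `K` and whose outer boundary is a longitude, Cromwell (2004),
proof of Thm. 5.8.1). [cite: GabaiJDG1987, Cor. 8.2] -/
structure NormalSeifertData (ν₀ : Knot.TubularNbhd K) (S : Type) [TopologicalSpace S]
    [ChartedSpace (EuclideanHalfSpace 2) S] [IsManifold (𝓡∂ 2) ∞ S]
    (e : ↥((𝓡∂ 2).boundary S) ≃ₜ ↥(𝕊 1)) (g : ℕ) (c : CapData S) where
  /-- The Seifert embedding `S ↪ 𝕊³ ⊆ ℝ⁴`. -/
  F : S → 𝔼 4
  /-- It is a spanning surface of genus `g` with boundary identification `e`. -/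
  isSpanning : K.IsSpanningSurfaceOfGenus F e g
  /-- It lies on the unit sphere. -/
  norm_eq : ∀ x, ‖F x‖ = 1
  /-- The height profile: collar height `τ x` over fibre coordinate `x e₀`. -/
  τ : ℝ → ℝ
  /-- `τ 0 = 0`. -/
  τ_zero : τ 0 = 0
  /-- `τ` is continuous. -/
  continuous_τ : Continuous τ
  /-- `τ` is strictly increasing on `[0, ∞)`. -/
  strictMonoOn_τ : StrictMonoOn τ (Ici 0)
  /-- `0 ≤ τ x < 1/4` for `x ≥ 0`. -/
  τ_mem : ∀ x, 0 ≤ x → 0 ≤ τ x ∧ τ x < 1 / 4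
  /-- The amplitude `a > 0` of the height profile. -/
  coefA : ℝ
  /-- The rate `b > 0` of the height profile. -/
  coefB : ℝ
  /-- `0 < a`. -/
  coefA_pos : 0 < coefA
  /-- `0 < b`. -/
  coefB_pos : 0 < coefB
  /-- **The height profile is the explicit diffeomorphism `τ x = a x / √(1 + (b x)²)` of `[0, ∞)`
  onto `[0, a/b)`** (so consumers may invert it smoothly). -/
  τ_eq : ∀ x, τ x = coefA * x * (√(1 + (coefB * x) ^ 2))⁻¹
  /-- **The positive half-discs of the unit tube are the collar**:
  `F (CS (z, τ x)) = ν₀ (e z, x e₀)` for `0 ≤ x < 1`. -/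
  apply_collar : ∀ (z : (𝓡∂ 2).boundary S) (x : ℝ), 0 ≤ x → x < 1 →
    F (c.CS.toFun z (τ x)) = ((ν₀ (e z, EuclideanSpace.single 0 x) : 𝕊 3) : 𝔼 4)
  /-- **The unit tube meets the surface only in those half-discs.** -/
  eq_collar_of_apply_eq : ∀ (y : S) (u : 𝕊 1) (w : 𝔼 2), ‖w‖ < 1 →
    ((ν₀ (u, w) : 𝕊 3) : 𝔼 4) = F y →
      ∃ x : ℝ, 0 ≤ x ∧ x < 1 ∧ w = EuclideanSpace.single 0 x ∧ y = c.CS.toFun (e.symm u) (τ x)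

namespace IsSpanningSurfaceOfGenus

variable {S : Type} [TopologicalSpace S] [ChartedSpace (EuclideanHalfSpace 2) S]
  [IsManifold (𝓡∂ 2) ∞ S] {F : S → 𝔼 4} {e : ↥((𝓡∂ 2).boundary S) ≃ₜ ↥(𝕊 1)} {g : ℕ}
  (c : CapData S)

/-- Scalar multiples of points of the `w₀`-axis. [folklore] -/
theorem smul_single_zero_axis (a x : ℝ) :
    a • (EuclideanSpace.single (0 : Fin 2) x : 𝔼 2) = EuclideanSpace.single 0 (a * x) := by
  rw [euclideanSpace_single_eq_smul (0 : Fin 2) x, smul_smul, ← euclideanSpace_single_eq_smul]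

/-! ### The adapted tube has framing zero -/

omit [IsManifold (𝓡∂ 2) ∞ S] in
/-- The boundary loop `t ↦ e⁻¹ (e^{2πit})` of `S`. [folklore] -/
def boundaryLoop (e : ↥((𝓡∂ 2).boundary S) ≃ₜ ↥(𝕊 1)) :
    Path (e.symm (circlePoint 0)) (e.symm (circlePoint 0)) where
  toFun t := e.symm (circlePoint (2 * Real.pi * t))
  continuous_toFun := e.symm.continuous.comp (continuous_circlePoint.comp (continuous_const.mul
    continuous_subtype_val))
  source' := by simp
  target' := by
    show e.symm (circlePoint (2 * Real.pi * (1 : ℝ))) = e.symm (circlePoint 0)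
    rw [mul_one, ← zero_add (2 * Real.pi), circlePoint_add_two_pi]

omit [IsManifold (𝓡∂ 2) ∞ S] in
/-- The value of the boundary loop. [folklore] -/
@[simp] theorem boundaryLoop_apply (e : ↥((𝓡∂ 2).boundary S) ≃ₜ ↥(𝕊 1)) (t : unitInterval) :
    boundaryLoop e t = e.symm (circlePoint (2 * Real.pi * t)) := rfl

/-- **The tube adapted to a Seifert surface has framing `0`** (the Seifert framing is the zero
framing, Juhász 2023 Rem. 4.12; Gabai 1987 Def. 8.1): its longitude is a collar loop of the
surface, null-homologous in the knot complement (`SeifertFramingZero.lean`). [cite: Juhasz2023, Remark 4.12] -/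
theorem hasFraming_zero_adaptedTube [T2Space S] [CompactSpace S] [ConnectedSpace S]
    [Nonempty ((𝓡∂ 2).boundary S)] (hF : K.IsSpanningSurfaceOfGenus F e g) (hF1 : ∀ x, ‖F x‖ = 1) :
    (hF.adaptedTube c hF1).HasFraming 0 :=
  hF.hasFraming_zero_of_longitude_eq hF1 c (hF.adaptedTube c hF1) (boundaryLoop e)
    (hF.adaptedHeight_half_mem c hF1).1
    ((hF.adaptedHeight_half_mem c hF1).2.trans (by norm_num))
    fun t ↦ by rw [hF.coe_longitude_adaptedTube c hF1 t, boundaryLoop_apply]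

/-! ### Transporting a Seifert surface along a diffeomorphism of the sphere fixing the knot -/

/-- A Seifert surface as a map into the sphere `𝕊³`. [folklore] -/
def toSphere (_hF : K.IsSpanningSurfaceOfGenus F e g) (hF1 : ∀ x, ‖F x‖ = 1) (y : S) : 𝕊 3 :=
  ⟨F y, seifert_apply_mem_sphere hF1 y⟩

/-- The value of `toSphere`. [folklore] -/
@[simp] theorem coe_toSphere (hF : K.IsSpanningSurfaceOfGenus F e g) (hF1 : ∀ x, ‖F x‖ = 1) (y : S) :
    (hF.toSphere hF1 y : 𝔼 4) = F y := rfl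

/-- `toSphere` is smooth. [folklore] -/
theorem contMDiff_toSphere (hF : K.IsSpanningSurfaceOfGenus F e g) (hF1 : ∀ x, ‖F x‖ = 1) :
    ContMDiff (𝓡∂ 2) (𝓡 3) ∞ (hF.toSphere hF1) :=
  hF.2.1.codRestrict_sphere (n := 3) fun y ↦ (hF.toSphere hF1 y).2

/-- The differential of `toSphere` is injective. [folklore] -/
theorem mfderiv_toSphere_injective (hF : K.IsSpanningSurfaceOfGenus F e g) (hF1 : ∀ x, ‖F x‖ = 1)
    (y : S) : Injective (mfderiv (𝓡∂ 2) (𝓡 3) (hF.toSphere hF1) y) := by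
  have hn : (∞ : WithTop ℕ∞) ≠ 0 := by simp
  have h1 : MDifferentiableAt (𝓡∂ 2) (𝓡 3) (hF.toSphere hF1) y :=
    (hF.contMDiff_toSphere hF1 y).mdifferentiableAt hn
  have h2 : MDifferentiableAt (𝓡 3) 𝓘(ℝ, 𝔼 4) (Subtype.val : (𝕊 3) → 𝔼 4) (hF.toSphere hF1 y) :=
    (contMDiff_coe_sphere (hF.toSphere hF1 y)).mdifferentiableAt hn
  have hcomp := mfderiv_comp y h2 h1
  have hF' : (Subtype.val ∘ hF.toSphere hF1) = F := rfl
  rw [hF'] at hcomp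
  have hinj := hF.2.2.2.1 y
  rw [hcomp] at hinj
  exact Injective.of_comp hinj

/-- On the boundary, `toSphere` is the knot. [folklore] -/
theorem toSphere_boundary (hF : K.IsSpanningSurfaceOfGenus F e g) (hF1 : ∀ x, ‖F x‖ = 1)
    (z : (𝓡∂ 2).boundary S) : hF.toSphere hF1 z = K (e z) :=
  Subtype.ext (hF.2.2.2.2.1 z)

/-- **The transport of a Seifert surface along a diffeomorphism `Φ` of `𝕊³`**: `Φ ∘ F`. [folklore] -/
def transport (hF : K.IsSpanningSurfaceOfGenus F e g) (hF1 : ∀ x, ‖F x‖ = 1)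
    (Φ : (𝕊 3) ≃ₘ⟮𝓡 3, 𝓡 3⟯ (𝕊 3)) (y : S) : 𝔼 4 :=
  ((Φ (hF.toSphere hF1 y) : 𝕊 3) : 𝔼 4)

/-- The value of the transport. [folklore] -/
theorem transport_apply (hF : K.IsSpanningSurfaceOfGenus F e g) (hF1 : ∀ x, ‖F x‖ = 1)
    (Φ : (𝕊 3) ≃ₘ⟮𝓡 3, 𝓡 3⟯ (𝕊 3)) (y : S) :
    hF.transport hF1 Φ y = ((Φ (hF.toSphere hF1 y) : 𝕊 3) : 𝔼 4) := rfl

/-- The transport lies on the unit sphere. [folklore] -/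
theorem norm_transport (hF : K.IsSpanningSurfaceOfGenus F e g) (hF1 : ∀ x, ‖F x‖ = 1)
    (Φ : (𝕊 3) ≃ₘ⟮𝓡 3, 𝓡 3⟯ (𝕊 3)) (y : S) : ‖hF.transport hF1 Φ y‖ = 1 :=
  norm_eq_of_mem_sphere _

/-- **The transport of a Seifert surface along a diffeomorphism of `𝕊³` fixing the knot pointwise
is a Seifert surface** of the same knot, genus and boundary identification. [folklore] -/
theorem transport_isSpanning (hF : K.IsSpanningSurfaceOfGenus F e g) (hF1 : ∀ x, ‖F x‖ = 1)
    (Φ : (𝕊 3) ≃ₘ⟮𝓡 3, 𝓡 3⟯ (𝕊 3)) (hΦ : ∀ u, Φ (K u) = K u) :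
    K.IsSpanningSurfaceOfGenus (hF.transport hF1 Φ) e g := by
  have hn : (∞ : WithTop ℕ∞) ≠ 0 := by simp
  obtain ⟨ho, hsm, hinj, himm, hbd, hgen⟩ := hF
  have hF : K.IsSpanningSurfaceOfGenus F e g := ⟨ho, hsm, hinj, himm, hbd, hgen⟩
  refine ⟨ho, ?_, ?_, ?_, ?_, hgen⟩
  · exact contMDiff_coe_sphere.comp (Φ.contMDiff.comp (hF.contMDiff_toSphere hF1))
  · intro a b hab
    have h1 : Φ (hF.toSphere hF1 a) = Φ (hF.toSphere hF1 b) := Subtype.ext hab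
    have h2 := congrArg Subtype.val (Φ.injective h1)
    exact hinj h2
  · intro y
    have h1 : MDifferentiableAt (𝓡∂ 2) (𝓡 3) (hF.toSphere hF1) y :=
      (hF.contMDiff_toSphere hF1 y).mdifferentiableAt hn
    have h2 : MDifferentiableAt (𝓡 3) (𝓡 3) Φ (hF.toSphere hF1 y) := (Φ.contMDiff _).mdifferentiableAt hn
    have h3 : MDifferentiableAt (𝓡 3) 𝓘(ℝ, 𝔼 4) (Subtype.val : (𝕊 3) → 𝔼 4) (Φ (hF.toSphere hF1 y)) :=
      (contMDiff_coe_sphere _).mdifferentiableAt hn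
    rw [show hF.transport hF1 Φ = Subtype.val ∘ (Φ ∘ hF.toSphere hF1) from rfl,
      mfderiv_comp y h3 (h2.comp y h1), mfderiv_comp y h2 h1]
    exact (mfderiv_coe_sphere_injective (n := 3) _).comp
      ((Φ.mfderivToContinuousLinearEquiv hn _).injective.comp (hF.mfderiv_toSphere_injective hF1 y))
  · intro z
    rw [transport_apply, hF.toSphere_boundary hF1 z, hΦ]

/-! ### Normal position -/

/-- **Seifert surfaces can be put in normal position with respect to any `0`-framed tube** (the
differential-topological content of Gabai's `Ŝ - N̊(k) = S`, Cor. 8.2; Cromwell (2004), proof of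
Thm. 5.8.1, Steps 1–5 in the smooth setting). Given a Seifert surface `F` of genus `g` of `K`,
capping data `c` for the abstract surface and an oriented tubular neighbourhood `ν₀` of `K` of
framing `0`, there is a Seifert surface of the same genus (the transport of `F` along an ambient
diffeomorphism fixing `K`) in normal position with respect to `ν₀` and `c.CS`. Proof: the tube
`ν` adapted to `F` (`adaptedTube`) has framing `0` (`hasFraming_zero_adaptedTube`), hence so has
its rescaling `ν.scale r` to a thin radius `r`; by uniqueness of `0`-framed tubes
(`Knot.TubularNbhd.exists_diffeomorph_eq_of_hasFraming`, Kosinski III.3.5 / Gompf–Stipsicz §4.5)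
an ambient diffeomorphism `Φ` fixing `K` carries the unit tube of `ν.scale r` onto that of `ν₀`
fibrewise, and `Φ ∘ F` is the required surface, with height profile `τ x = ρ (r x)`.
[cite: GabaiJDG1987, Cor. 8.2] [cite: Cromwell2004, Thm. 5.8.1 (proof)] -/
theorem nonempty_normalSeifertData [T2Space S] [CompactSpace S] [ConnectedSpace S]
    [Nonempty ((𝓡∂ 2).boundary S)] (hF : K.IsSpanningSurfaceOfGenus F e g) (hF1 : ∀ x, ‖F x‖ = 1)
    (ν₀ : Knot.TubularNbhd K) (h0 : ν₀.HasFraming 0) :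
    Nonempty (K.NormalSeifertData ν₀ S e g c) := by
  set ν := hF.adaptedTube c hF1 with hν
  -- a thin radius `r`
  obtain ⟨r₁, hr₁, hthin⟩ := hF.exists_radius_forall_eq_single c hF1
  set r : ℝ := min r₁ 1 with hr
  have hr0 : 0 < r := lt_min hr₁ one_pos
  have hrr₁ : r ≤ r₁ := min_le_left _ _
  have hr1 : r ≤ 1 := min_le_right _ _
  -- the rescaled adapted tube has framing `0`; match it with `ν₀`
  have hfr : (ν.scale r hr0).HasFraming 0 := (hF.hasFraming_zero_adaptedTube c hF1).scale ν r hr0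
  obtain ⟨Φ, hΦK, hΦν⟩ := Knot.TubularNbhd.exists_diffeomorph_eq_of_hasFraming _ _ hfr h0
  -- the transported surface and its height profile
  set τ : ℝ → ℝ := fun x ↦ hF.adaptedHeight c hF1 (r * x) with hτ
  have hτ0 : ∀ x, 0 ≤ x → 0 ≤ τ x ∧ τ x < 1 / 4 := fun x hx ↦
    ⟨hF.adaptedHeight_nonneg c hF1 (mul_nonneg hr0.le hx),
      ((le_abs_self _).trans_lt (hF.abs_adaptedHeight_lt c hF1 _)).trans_le (hF.adaptedRadius_le c hF1)⟩
  refine ⟨{ F := hF.transport hF1 Φ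
            isSpanning := hF.transport_isSpanning hF1 Φ hΦK
            norm_eq := hF.norm_transport hF1 Φ
            τ := τ
            τ_zero := by simp [hτ]
            continuous_τ := (hF.continuous_adaptedHeight c hF1).comp (continuous_const.mul continuous_id)
            strictMonoOn_τ := ?_
            τ_mem := hτ0
            coefA := hF.adaptedRadius c hF1 * r
            coefB := r
            coefA_pos := mul_pos (hF.adaptedRadius_pos c hF1) hr0
            coefB_pos := hr0
            τ_eq := fun x ↦ by simp only [hτ]; rw [hF.adaptedHeight_eq c hF1]; ring
            apply_collar := ?_
            eq_collar_of_apply_eq := ?_ }⟩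
  · intro x hx y hy hxy
    exact hF.strictMonoOn_adaptedHeight c hF1 (mul_nonneg hr0.le hx) (mul_nonneg hr0.le hy)
      (mul_lt_mul_of_pos_left hxy hr0)
  · intro z x hx0 hx1
    have hw : ‖(EuclideanSpace.single (0 : Fin 2) x : 𝔼 2)‖ < 1 := by
      rw [PiLp.norm_single, Real.norm_eq_abs, abs_of_nonneg hx0]; exact hx1
    have h1 := hΦν (e z) (EuclideanSpace.single 0 x) hw
    rw [Knot.TubularNbhd.scale_apply] at h1
    have h2 : r • (EuclideanSpace.single (0 : Fin 2) x : 𝔼 2) = EuclideanSpace.single 0 (r * x) :=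
      smul_single_zero_axis r x
    simp only [h2] at h1
    have h3 : ν (e z, EuclideanSpace.single 0 (r * x)) =
        hF.toSphere hF1 (c.CS.toFun z (hF.adaptedHeight c hF1 (r * x))) :=
      Subtype.ext (hF.adaptedTube_apply_single c hF1 z (mul_nonneg hr0.le hx0))
    rw [transport_apply, ← h1, h3]
  · intro y u w hw heq
    -- pull back through `Φ`: `Φ (toSphere y) = ν₀ (u, w) = Φ (ν (u, r • w))`
    have h1 := hΦν u w hw
    rw [Knot.TubularNbhd.scale_apply] at h1
    have h2 : Φ (hF.toSphere hF1 y) = Φ (ν (u, r • w)) := by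
      apply Subtype.ext
      rw [h1]
      exact heq.symm
    have h3 : hF.toSphere hF1 y = ν (u, r • w) := Φ.injective h2
    have h4 : ((ν (u, r • w) : 𝕊 3) : 𝔼 4) = F y := by rw [← h3]; rfl
    have hrw : ‖r • w‖ < r₁ := by
      rw [norm_smul, Real.norm_of_nonneg hr0.le]
      calc r * ‖w‖ < r * 1 := mul_lt_mul_of_pos_left hw hr0
        _ ≤ r₁ := by rw [mul_one]; exact hrr₁
    obtain ⟨x', hx'0, hx'w, hy⟩ := hthin y u (r • w) hrw h4
    -- `w = (x'/r) e₀`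
    refine ⟨x' / r, div_nonneg hx'0 hr0.le, ?_, ?_, ?_⟩
    · -- `x' = r (x'/r) ≤ r ‖w‖·?`: from `r • w = x' e₀`, `x' = ‖r • w‖ < r`
      have hx'r : x' < r := by
        have := congrArg (fun v : 𝔼 2 ↦ ‖v‖) hx'w
        simp only [PiLp.norm_single, Real.norm_eq_abs, abs_of_nonneg hx'0, norm_smul,
          Real.norm_of_nonneg hr0.le] at this
        calc x' = r * ‖w‖ := this.symm
          _ < r * 1 := mul_lt_mul_of_pos_left hw hr0
          _ = r := mul_one r
      rwa [div_lt_one hr0]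
    · have h5 : w = r⁻¹ • (r • w) := by rw [smul_smul, inv_mul_cancel₀ hr0.ne', one_smul]
      rw [h5, hx'w, smul_single_zero_axis, div_eq_inv_mul]
    · rw [hy]
      show c.CS.toFun (e.symm u) (hF.adaptedHeight c hF1 x') =
        c.CS.toFun (e.symm u) (hF.adaptedHeight c hF1 (r * (x' / r)))
      rw [mul_div_cancel₀ _ hr0.ne']

end IsSpanningSurfaceOfGenus

/-- **Normal position of Seifert surfaces, existential form.** For every knot `K`, every oriented
tubular neighbourhood `ν₀` of `K` of framing `0` (e.g. the tube of a zero frame surgery,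
`IsIntegralSurgery _ _ K 0`) and every genus `g` in which `K` has a Seifert surface, there is a
Seifert surface of genus `g` in normal position with respect to `ν₀`: a compact connected
orientable surface `S` with one boundary circle, capping data `c` (boundary diffeomorphisms and
long open collars) and normal Seifert data over it. [cite: GabaiJDG1987, Cor. 8.2] -/
theorem exists_normalSeifertData (K : Knot) (ν₀ : Knot.TubularNbhd K) (h0 : ν₀.HasFraming 0) {g : ℕ}
    (hg : K.HasSeifertSurfaceOfGenus g) :
    ∃ (S : Type) (_ : TopologicalSpace S) (_ : T2Space S) (_ : SecondCountableTopology S)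
      (_ : CompactSpace S) (_ : ConnectedSpace S) (_ : ChartedSpace (EuclideanHalfSpace 2) S)
      (_ : IsManifold (𝓡∂ 2) ∞ S) (e : ↥((𝓡∂ 2).boundary S) ≃ₜ ↥(𝕊 1)) (c : CapData S),
      Nonempty (K.NormalSeifertData ν₀ S e g c) := by
  obtain ⟨S, _, _, _, _, _, _, _, F, e, hF, hF1⟩ := hg
  haveI : Nonempty ((𝓡∂ 2).boundary S) := ⟨e.symm (circlePoint 0)⟩
  obtain ⟨c⟩ := CapData.nonempty e hF.1
  exact ⟨S, inferInstance, inferInstance, inferInstance, inferInstance, inferInstance, inferInstance,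
    inferInstance, e, c, hF.nonempty_normalSeifertData c hF1 ν₀ h0⟩

end Knot

end Literature.Topology.FourManifolds
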